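import Summits.HodgeConjecture.CorCM.Stage4StrictRoadDischarge
import Summits.Ventures.HodgeKum4.Statement
import HarnessLib

/-!
# SCRATCH (plan g19, de-risking the L2 birth line `Lines/birth.lean` stub `stub_dominatedHodge`):
Arapura 2006 Lemma 4.2 (HC clause) in IMAGE form — a rational `(p,p)`-class lying in `dominatedClasses dY Y dB B (2p)`
(the span of images of algebraic correspondences from powers of `B`) is algebraic, given HC for the positive powers of `B`.
The proof is the tree's `Stage4.hodgeConjectureFor_of_isDominatedByPowers` VERBATIM with its first step
(`span_rationalAlgebraicCorrRanges_eq_top`, the `= ⊤` form) replaced by the inclusion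
`dominatedClasses … ≤ span {images of (γ)_* , γ rational algebraic}` (the same generator-wise argument).
A prover (p2 g12) may file this as `Theorems/KummerFixedLocusL2DominatedHodge.lean --supports stmt-Ventures-19136`.
Nothing here says L2 ∕ L1 ∕ HC_Kum4Type ∕ HC is proved.
-/

noncomputable section

namespace Summit.HodgeConjecture.CorCM.Stage4.KummerL2Scratch

open CategoryTheory MonoidalCategory CartesianMonoidalCategory
open scoped TensorProduct Manifold ContDiff
open Literature.AlgebraicGeometry Literature.AlgebraicGeometry.Motives Literature.AlgebraicGeometry.HodgeTheory
open Literature.AlgebraicTopology.SingularHomology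
open Summit.HodgeConjecture.CorCM.Stage4
open Summit.Ventures.HodgeKum4 (dominatedClasses)

variable {dX dY : ℕ} {X Y : SchemeOver ℂ}

/-- Generator-wise: every class in `dominatedClasses dY Y dX X (2p)` lies in the `ℂ`-span of the images of the
`γ_*`, `γ` RATIONAL algebraic on `Y ⊗ Xᵉ` (the inclusion inside `span_rationalAlgebraicCorrRanges_eq_top`). -/
theorem dominatedClasses_le_span_rational (hX : IsSmoothProjective dX X) (hY : IsSmoothProjective dY Y) (p : ℕ) :
    dominatedClasses dY Y dX X (2 * p) ≤
      Submodule.span ℂ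
        {c : complexBetti Y (2 * p) |
          ∃ (e cd d : ℕ) (hab : 2 * d + 2 * cd = 2 * p + 2 * (e * dX))
            (γ : complexBetti (Y ⊗ X.pow e) (2 * cd)),
            IsRationalClass γ ∧ γ ∈ algebraicClasses (Y ⊗ X.pow e) cd ∧
              c ∈ LinearMap.range (corrAction complexOrientationFamily hY (hX.pow e) hab γ)} := by
  unfold dominatedClasses
  refine Submodule.span_le.2 ?_
  rintro c ⟨e, a, T, hT, ⟨x, rfl⟩⟩
  obtain ⟨cd, hab, γ, hγ, rfl⟩ :=
    Summit.HodgeConjecture.HodgeConjecture.Ring2.AbelianAll.IsAlgebraicCorrespondence.exists_eq_corrAction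
      hY (hX.pow e) hT
  obtain ⟨d, rfl⟩ : ∃ d, a = 2 * d := ⟨a / 2, by omega⟩
  have hYXe := IsSmoothProjective.tensor_holds hY (hX.pow e)
  have hγ' := algebraicClasses_le_span_isRationalClass hYXe cd hγ
  have hlin : corrAction complexOrientationFamily hY (hX.pow e) hab γ x =
      ((corrAction complexOrientationFamily hY (hX.pow e) hab).flip x) γ := by
    rw [LinearMap.flip_apply]
  rw [SetLike.mem_coe, hlin]
  have hmem : ((corrAction complexOrientationFamily hY (hX.pow e) hab).flip x) γ ∈
      (Submodule.span ℂ {g : complexBetti (Y ⊗ X.pow e) (2 * cd) |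
          IsRationalClass g ∧ g ∈ algebraicClasses (Y ⊗ X.pow e) cd}).map
        ((corrAction complexOrientationFamily hY (hX.pow e) hab).flip x) :=
    Submodule.mem_map_of_mem hγ'
  rw [Submodule.map_span] at hmem
  refine Submodule.span_mono ?_ hmem
  rintro _ ⟨g, ⟨hg₁, hg₂⟩, rfl⟩
  exact ⟨e, cd, d, hab, g, hg₁, hg₂, x, by rw [LinearMap.flip_apply]⟩

/-- **Arapura's Lemma 4.2 in IMAGE form**: a rational `(p,p)`-class of `Y` dominated by the powers of `X` is algebraic,
given the Hodge conjecture for the positive powers of `X` (the tree's `hodgeConjectureFor_of_isDominatedByPowers`,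
class by class). [cite: Arapura2006, Lemma 4.2 and Lemma 1.1] [cite: Voisin2025, Cor. 2.12] -/
theorem mem_algebraicClasses_of_mem_dominatedClasses (hX : IsSmoothProjective dX X)
    (hY : IsSmoothProjective dY Y) (hpow : ∀ m : ℕ, HodgeConjectureFor ((m + 1) * dX) (X.pow (m + 1)))
    (p : ℕ) (c : complexBetti Y (2 * p)) (hc : IsRationalClass c) (hpp : IsOfHodgeType dY Y (2 * p) p p c)
    (hcd : c ∈ dominatedClasses dY Y dX X (2 * p)) : c ∈ algebraicClasses Y p := by
  classical
  by_cases hp : 2 * dY < 2 * p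
  · haveI := subsingleton_complexBetti hY hp
    rw [Subsingleton.elim c 0]
    exact Submodule.zero_mem _
  obtain ⟨k, hk⟩ : ∃ k, 2 * p + k = 2 * dY := ⟨2 * dY - 2 * p, by omega⟩
  have hpow' := hodgeConjectureFor_pow_of_succ hX hpow
  have hc1 := dominatedClasses_le_span_rational hX hY p hcd
  obtain ⟨T, hTS, hcT⟩ := Submodule.mem_span_finite_of_mem_span hc1
  have hdata : ∀ t : T, ∃ (e cd d : ℕ) (hab : 2 * d + 2 * cd = 2 * p + 2 * (e * dX))
      (γ : complexBetti (Y ⊗ X.pow e) (2 * cd)),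
      IsRationalClass γ ∧ γ ∈ algebraicClasses (Y ⊗ X.pow e) cd ∧
        (t : complexBetti Y (2 * p)) ∈
          LinearMap.range (corrAction complexOrientationFamily hY (hX.pow e) hab γ) :=
    fun t ↦ hTS t.2
  choose e cd d hab γ hγr hγa hγt using hdata
  obtain ⟨a, ha, hsum⟩ := exists_isRationalClass_isOfHodgeType_eq_sum_int hY
    (ι := T) (m := fun t ↦ e t * dX) (d := d) (Y := fun t ↦ X.pow (e t)) (fun t ↦ hX.pow (e t)) p
    (fun t ↦ (cd t : ℤ) - (e t * dX : ℕ)) (fun t ↦ by have := hab t; push_cast; omega)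
    (fun t ↦ corrAction complexOrientationFamily hY (hX.pow (e t)) (hab t) (γ t))
    (fun t y hy ↦ isRationalClass_corrAction_complex hY (hX.pow (e t)) (hab t) (hγr t) hy)
    (fun t p₀ q₀ y _ hy p₁ q₁ hp₁ hq₁ ↦ isOfHodgeType_corrAction_complex hY (hX.pow (e t)) (hab t)
      (isOfHodgeType_of_mem_algebraicClasses_of_isSmoothProjective
        (IsSmoothProjective.tensor_holds hY (hX.pow (e t))) (cd t) (hγa t))
      (by push_cast at hp₁; omega) (by push_cast at hq₁; omega) hy)
    (fun t p₀ q₀ y _ hy hlt ↦ corrAction_eq_zero_of_hodgeType_lt hY (hX.pow (e t)) (hab t)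
      (isOfHodgeType_of_mem_algebraicClasses_of_isSmoothProjective
        (IsSmoothProjective.tensor_holds hY (hX.pow (e t))) (cd t) (hγa t))
      (by push_cast at hlt; omega) hy)
    hc hpp (Submodule.span_le.2 (fun t ht ↦ Submodule.mem_iSup_of_mem (⟨t, ht⟩ : T) (hγt ⟨t, ht⟩)) hcT)
  rw [hsum]
  refine Submodule.sum_mem _ fun t _ ↦ ?_
  exact corrAction_mem_algebraicClasses_complex hY (hX.pow (e t)) (hab t) hk (hγa t)
    ((hpow' (e t)).2 (d t) (a t) (ha t).1 (ha t).2)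

/-- The statement of the L2 birth stub `Birth.DominatedHodgeClassesAlgebraic` (bc19136_birth.lean 7f624074b07238af), verbatim,
PROVED. -/
theorem dominatedHodgeClassesAlgebraic :
    ∀ ⦃dB : ℕ⦄ ⦃B : Motives.SchemeOver ℂ⦄ ⦃dY : ℕ⦄ ⦃Y : Motives.SchemeOver ℂ⦄,
      Motives.IsSmoothProjective dB B → Motives.IsSmoothProjective dY Y →
        (∀ m : ℕ, HodgeConjectureFor ((m + 1) * dB) (B.pow (m + 1))) →
          ∀ (p : ℕ) (c : complexBetti Y (2 * p)), IsRationalClass c → IsOfHodgeType dY Y (2 * p) p p c →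
            c ∈ dominatedClasses dY Y dB B (2 * p) → c ∈ algebraicClasses Y p :=
  fun _ _ _ _ hB hY hpow p c hc hpp hcd ↦ mem_algebraicClasses_of_mem_dominatedClasses hB hY hpow p c hc hpp hcd

end Summit.HodgeConjecture.CorCM.Stage4.KummerL2Scratch

end
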